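import Summits.BirchSwinnertonDyer.BirchSwinnertonDyer.Theorems.ManinLocalTwoThreeStevensCuspRational
import Summits.BirchSwinnertonDyer.BirchSwinnertonDyer.Theorems.ManinLocalTwoThreeStevensInfinityFibreRational
import Summits.BirchSwinnertonDyer.BirchSwinnertonDyer.Theorems.ManinLocalTwoThreeFlatGamma1Datum
import Literature.NumberTheory.EllipticCurves.ModularParametrizationCuspZeroRationality
import Literature.NumberTheory.EllipticCurves.ModularSymbolsManinDrinfeldGeneralProofs
import HarnessLib

/-!
# F★₀ `optimalParametrization_cuspZero_rational` — PROVED: the `X₀(N)`-parametrisation maps the cusp `0` to a RATIONAL torsion point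
(route `ManinLocalTwoThree`, crux C2 `ManinOddAtFour` stmt-BirchSwinnertonDyer-22967; cell bsd-f2-manin, prover seat p3 gen 21;
`--supports stmt-BirchSwinnertonDyer-22967`)

The tree's named Literature fact `optimalParametrization_cuspZero_rational` (es F1 / an's F★₀: for an `X₀(N)`-datum `D` of an elliptic `W/ℚ`,
`π(c_D·{∞,0}_f)` is the base change of a point of `W(ℚ)`) is discharged, with its lattice clause idle:

* §1 **`map_uniformize_cuspZero_eq_self`** — every `σ ∈ Aut(ℂ/ℚ)` FIXES `π(c_D·{∞,0}_f)` for every `X₀(N)`-datum `D`.  The cusp `0` is `S∞`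
  (`S = (0 −1; 1 0)`); with `σ(e^{2πi/N}) = e^{2πid/N}`, `dd′ ≡ 1 (N)` (`StevensGalois.exists_exp_conj_pow`) and a lift `γ′ ∈ SL₂(ℤ)` of
  `(0 −d; d′ 0) (mod N)` off `∞` (`StevensGalois.exists_lift_lowerLeft_ne_zero`), LEAD's Stevens-(b) transport for arbitrary pairs
  (`StevensGalois.map_uniformize_cusp_general`, run on the `X₁(N)`-restriction `FlatGamma1Datum.exists_gamma1ParametrizationData_of_datum` of `D`)
  gives `σ(π(c{∞,0})) = π(c{∞, γ′∞})`; and `γ′∞ = δ·0` for `δ = (−γ′₀₁ γ′₀₀; −γ′₁₁ γ′₁₀) ∈ Γ₀(N)`, so Manin's relation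
  `{∞, δ0} = {∞, δ∞} + {∞, 0}` (`modularSymbol_gamma0_smul_holds`) and `c·{∞,δ∞} ∈ c·Λ₀(f) ⊆ Λ(D.L) = ker π` (`smul_periodLattice_le`) finish.
* §2 **`exists_ratPoint_eq_uniformize_cuspZero`** (descent `Fix(Aut(ℂ/ℚ)) = ℚ`, p2's `CuspValues.exists_ratPoint_of_forall_map_eq`), the torsion
  statement `isOfFinAddOrder_uniformize_cuspZero` (Manin–Drinfeld `exists_nsmul_modularSymbol_mem_periodLattice_holds`), and the named fact
  **`optimalParametrization_cuspZero_rational_holds`**.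

This discharges the binder `hF₀` of `…CThreeOfSixPrintedFacts`, `…CuspZeroAnnihilatorOfCuspGalois` (E-an-128 road) and es's F1.
HONEST FRAMING: unconditional and fact-free; nothing about C2/C3, Manin's conjecture or BSD is proved here.  No definitions, no sorry.
[cite: Manin1972, Thm. 1.9, Prop. 1.4, Cor. 3.6] [cite: Stevens1982, §1.3 Thm. 1.3.1 (a), (b)] [cite: ConradEdixhovenStein2003, §6.1.2] [cite: Drinfeld1973, Thm. 1]
-/

set_option autoImplicit false
-- lint-debt: the directory name repeats the summit name (sibling precedent `ManinLocalTwoThreeStevensCuspRational.lean`)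
set_option linter.dupNamespace false

noncomputable section

open Complex
open scoped Real MatrixGroups PeriodPair
open CongruenceSubgroup WeierstrassCurve
open Literature.NumberTheory.EllipticCurves Literature.NumberTheory.EllipticCurves.ModularForms

namespace Summit.BirchSwinnertonDyer.BirchSwinnertonDyer.Theorems.ManinLocalTwoThree.StevensCurve

variable {N : ℕ} [NeZero N]

/-! ## §1 Every `σ ∈ Aut(ℂ/ℚ)` fixes the value at the cusp `0` -/

/-- **`σ(π(c_D·{∞,0}_f)) = π(c_D·{∞,0}_f)` for every `X₀(N)`-datum `D` and every `σ ∈ Aut(ℂ/ℚ)`** (Stevens 1982 Thm. 1.3.1 (b) for the pair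
`(S, γ′)`, `γ′ ≡ (0 −d; d′ 0)`, via LEAD's `map_uniformize_cusp_general`, plus Manin's relation for `γ′∞ = δ·0`, `δ ∈ Γ₀(N)`).
[cite: Stevens1982, §1.3 Thm. 1.3.1 (b)] [cite: Manin1972, Prop. 1.4, Thm. 1.6] -/
theorem map_uniformize_cuspZero_eq_self {W : WeierstrassCurve ℚ} [W.IsElliptic] (D : ModularParametrizationData W N)
    (σ : ℂ ≃ₐ[ℚ] ℂ) :
    Affine.Point.map (W' := W) (σ : ℂ →ₐ[ℚ] ℂ) (D.uniformize ((D.c : ℂ) * modularSymbol D.f 0)) =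
      D.uniformize ((D.c : ℂ) * modularSymbol D.f 0) := by
  classical
  obtain ⟨D₁, hf, hL, hu, hc⟩ := FlatGamma1Datum.exists_gamma1ParametrizationData_of_datum D
  obtain ⟨d, d', hdd, hσ⟩ := StevensGalois.exists_exp_conj_pow (N := N) σ
  have h2 : (d : ZMod N) * (d' : ZMod N) = 1 := by exact_mod_cast hdd
  -- `S` and a lift `γ′` of `(0 -d; d′ 0)` off `∞`
  set S' : SL(2, ℤ) := ⟨!![0, -1; 1, 0], by simp [Matrix.det_fin_two_of]⟩ with hS'
  have hS00 : (S' 0 0 : ℤ) = 0 := rfl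
  have hS01 : (S' 0 1 : ℤ) = -1 := rfl
  have hS10 : (S' 1 0 : ℤ) = 1 := rfl
  have hS11 : (S' 1 1 : ℤ) = 0 := rfl
  have hdetM : Matrix.det !![(0 : ZMod N), -(d : ZMod N); (d' : ZMod N), 0] = 1 := by
    rw [Matrix.det_fin_two_of]; linear_combination h2
  obtain ⟨γ', hγ'M, hγ'10⟩ := StevensGalois.exists_lift_lowerLeft_ne_zero (N := N) ⟨_, hdetM⟩
  have hent : ∀ i j : Fin 2, ((γ' i j : ℤ) : ZMod N) = !![(0 : ZMod N), -(d : ZMod N); (d' : ZMod N), 0] i j := by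
    intro i j
    have h := congrArg (fun m : SL(2, ZMod N) ↦ (m : Matrix (Fin 2) (Fin 2) (ZMod N)) i j) hγ'M
    simpa using h
  have h00 : ((γ' 0 0 : ℤ) : ZMod N) = ((S' 0 0 : ℤ) : ZMod N) := by
    rw [hS00]; simpa using hent 0 0
  have h01 : ((γ' 0 1 : ℤ) : ZMod N) = (d : ZMod N) * ((S' 0 1 : ℤ) : ZMod N) := by
    rw [hS01]; push_cast; simpa using hent 0 1
  have h10 : ((γ' 1 0 : ℤ) : ZMod N) = (d' : ZMod N) * ((S' 1 0 : ℤ) : ZMod N) := by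
    rw [hS10]; push_cast; simpa using hent 1 0
  have h11 : ((γ' 1 1 : ℤ) : ZMod N) = ((S' 1 1 : ℤ) : ZMod N) := by
    rw [hS11]; simpa using hent 1 1
  -- Stevens (b) for the pair `(S, γ′)` on the `X₁(N)`-restriction `D₁`
  have hT := StevensGalois.map_uniformize_cusp_general D₁ σ hdd hσ S' γ' (by rw [hS10]; exact one_ne_zero) hγ'10
    h00 h01 h10 h11
  have hS0 : ((S' 0 0 : ℤ) : ℚ) / ((S' 1 0 : ℤ) : ℚ) = 0 := by rw [hS00]; simp
  rw [hS0, hf, hu, hc] at hT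
  rw [hT]
  -- `γ′∞ = δ·0` with `δ = (−γ′₀₁ γ′₀₀; −γ′₁₁ γ′₁₀) ∈ Γ₀(N)`
  have hdetγ' : (γ' 0 0 : ℤ) * γ' 1 1 - γ' 0 1 * γ' 1 0 = 1 := by rw [← Matrix.det_fin_two, γ'.det_coe]
  set δ' : SL(2, ℤ) := ⟨!![-(γ' 0 1 : ℤ), (γ' 0 0 : ℤ); -(γ' 1 1 : ℤ), (γ' 1 0 : ℤ)], by
    rw [Matrix.det_fin_two_of]; linear_combination hdetγ'⟩ with hδ'
  have hδ00 : (δ' 0 0 : ℤ) = -(γ' 0 1 : ℤ) := rfl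
  have hδ01 : (δ' 0 1 : ℤ) = (γ' 0 0 : ℤ) := rfl
  have hδ10 : (δ' 1 0 : ℤ) = -(γ' 1 1 : ℤ) := rfl
  have hδ11 : (δ' 1 1 : ℤ) = (γ' 1 0 : ℤ) := rfl
  have hδΓ0 : δ' ∈ Gamma0 N := by
    rw [Gamma0_mem, hδ10]
    push_cast
    rw [h11, hS11]
    simp
  set δ : Gamma0 N := ⟨δ', hδΓ0⟩ with hδ
  have hcoe : ((δ : Gamma0 N) : SL(2, ℤ)) = δ' := rfl
  have hr : (((δ : Gamma0 N) : SL(2, ℤ)) 1 0 : ℚ) * 0 + (((δ : Gamma0 N) : SL(2, ℤ)) 1 1 : ℚ) ≠ 0 := by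
    rw [hcoe, hδ11, mul_zero, zero_add]
    exact_mod_cast hγ'10
  have hM := modularSymbol_gamma0_smul_holds D.f δ 0 hr
  have e : ((((δ : Gamma0 N) : SL(2, ℤ)) 0 0 : ℚ) * 0 + (((δ : Gamma0 N) : SL(2, ℤ)) 0 1 : ℚ)) /
      ((((δ : Gamma0 N) : SL(2, ℤ)) 1 0 : ℚ) * 0 + (((δ : Gamma0 N) : SL(2, ℤ)) 1 1 : ℚ)) =
      ((γ' 0 0 : ℤ) : ℚ) / ((γ' 1 0 : ℤ) : ℚ) := by
    rw [hcoe, hδ01, hδ11, mul_zero, zero_add, mul_zero, zero_add]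
  rw [e] at hM
  -- `c·{∞, δ∞} ∈ c·Λ₀(f) ⊆ Λ(D.L) = ker π`
  have hker : D.uniformize ((D.c : ℂ) * cuspSymbol D.f δ) = 0 := by
    rw [← AddMonoidHom.mem_ker, ← SetLike.mem_coe, D.ker_uniformize]
    exact D.smul_periodLattice_le _ (cuspSymbol_mem_periodLattice D.f δ)
  rw [hM, mul_add, map_add, hker, zero_add]

/-! ## §2 Rationality, torsion, and the named fact -/

/-- **The value of an `X₀(N)`-parametrisation at the cusp `0` is `ℚ`-RATIONAL**: `π(c_D·{∞,0}_f)` is the base change of a point of `W(ℚ)`,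
for EVERY `X₀(N)`-datum `D` (no lattice clause). [cite: Manin1972, Thm. 1.9, Cor. 3.6] [cite: ConradEdixhovenStein2003, §6.1.2] -/
theorem exists_ratPoint_eq_uniformize_cuspZero {W : WeierstrassCurve ℚ} [W.IsElliptic] (D : ModularParametrizationData W N) :
    ∃ P : (W.baseChange ℚ).toAffine.Point,
      Affine.Point.baseChange (W' := W) ℚ ℂ P = D.uniformize ((D.c : ℂ) * modularSymbol D.f 0) :=
  CuspValues.exists_ratPoint_of_forall_map_eq _ fun σ ↦ map_uniformize_cuspZero_eq_self D σ

/-- **… and TORSION** (Manin–Drinfeld: `n·{∞,0}_f ∈ Λ₀(f)` for some `n ≥ 1`, so `n • π(c{∞,0}) = 0`). [cite: Manin1972, Cor. 3.6] [cite: Drinfeld1973, Thm. 1] -/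
theorem isOfFinAddOrder_uniformize_cuspZero {W : WeierstrassCurve ℚ} [W.IsElliptic] (D : ModularParametrizationData W N) :
    IsOfFinAddOrder (D.uniformize ((D.c : ℂ) * modularSymbol D.f 0)) := by
  obtain ⟨n, hn, hmem⟩ := exists_nsmul_modularSymbol_mem_periodLattice_holds D.f 0
  refine isOfFinAddOrder_iff_nsmul_eq_zero.mpr ⟨n, hn, ?_⟩
  rw [← map_nsmul, ← AddMonoidHom.mem_ker, ← SetLike.mem_coe, D.ker_uniformize, nsmul_eq_mul, mul_left_comm, ← nsmul_eq_mul]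
  exact D.smul_periodLattice_le _ hmem

/-- **The rational point over the cusp `0` is torsion** (rational form of the previous two statements). [cite: Manin1972, Cor. 3.6] -/
theorem exists_ratPoint_torsion_eq_uniformize_cuspZero {W : WeierstrassCurve ℚ} [W.IsElliptic] (D : ModularParametrizationData W N) :
    ∃ P : (W.baseChange ℚ).toAffine.Point, IsOfFinAddOrder P ∧
      Affine.Point.baseChange (W' := W) ℚ ℂ P = D.uniformize ((D.c : ℂ) * modularSymbol D.f 0) := by
  obtain ⟨P, hP⟩ := exists_ratPoint_eq_uniformize_cuspZero D
  refine ⟨P, ?_, hP⟩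
  have hinj : Function.Injective (Affine.Point.baseChange (W' := W) ℚ ℂ) :=
    Affine.Point.map_injective (W' := W) (Algebra.ofId ℚ ℂ)
  obtain ⟨n, hn, h0⟩ := isOfFinAddOrder_iff_nsmul_eq_zero.mp (isOfFinAddOrder_uniformize_cuspZero D)
  refine isOfFinAddOrder_iff_nsmul_eq_zero.mpr ⟨n, hn, hinj ?_⟩
  rw [map_nsmul, hP, h0, map_zero]

/-- **F★₀ PROVED: `optimalParametrization_cuspZero_rational` HOLDS** — the named Literature fact verbatim (its lattice clause is unused).
[cite: Manin1972, Thm. 1.9, Cor. 3.6] [cite: Stevens1982, §1.3 Thm. 1.3.1 (a), (b)] [cite: ConradEdixhovenStein2003, §6.1.2] -/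
theorem optimalParametrization_cuspZero_rational_holds : optimalParametrization_cuspZero_rational :=
  fun _ _ _ _ D _ ↦ exists_ratPoint_eq_uniformize_cuspZero D

end Summit.BirchSwinnertonDyer.BirchSwinnertonDyer.Theorems.ManinLocalTwoThree.StevensCurve

end
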